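import Literature.AlgebraicGeometry.Frobenioids.PerfectionFrobeniusCompact
import HarnessLib

/-!
# Frobenioids I, Def. 1.2 (iv): a divisor criterion for Frobenius-compactness — PROOF (pure algebra)

Mochizuki, *The geometry of Frobenioids I: the general theory*, Kyushu J. Math. **62** (2008) 293–400,
Definition 1.2 (iv), kurims text p. 23 (Frobenius-compact objects); used in the proofs of Thm. 6.2 (iii)
p. 112 l. 8–15 and Thm. 6.4 (i) p. 115 l. 22–23 ("every object of `(C^un-tr)^birat` is Frobenius-compact":
an automorphism acts on the divisors of units through a finite-order automorphism of the base, so an action by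
`λ ∈ ℚ_{>0}` on a non-zero divisor forces `λ = 1`). [cite: MochizukiFrdI2008, Def. 1.2 (iv) p.23]

PROOF-ONLY (seat abc-iut-L1-t3 gen 4; first layer of the T64i/L10(b) · T62iii/L10 assembly «`(C^un-tr)^birat`
admits a Frobenius-compact object» at the constructions). The three clauses of
`PreFrobenioidData.IsFrobeniusCompact S A` (abc-iut-found/abc-iut-L1-t3's rendering of Def. 1.2 (iv)) are derived
from a **divisor homomorphism** on the units: given
* `δ : O^×(A) →* M` INJECTIVE into a commutative group `M` without torsion ("a unit is determined by its divisor"),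
* an action `T : Aut(A) →* MulAut M` through which conjugation acts on divisors, `δ(f u f⁻¹) = T_f(δ u)`, every
  `T_f` of FINITE ORDER ("`Aut(A)` acts on divisors through the finite group of base automorphisms"),
* one unit `u₀` with `δ u₀ ≠ 1` ("a rational function with non-zero divisor"),
then `A` is Frobenius-compact (normality of `O^×(A)` in `Aut(A)` is abc-iut-w5-d042's
`PreFrobenioidData.conj_mem_unitsSubgroup`, `PerfectionFrobeniusCompact.lean`, cited not restated): `O^×(A)` is commutative (`δ` injective into a commutative group), `u₀` is
non-torsion, and if `f` acts on `O^×(A)^pf` by `p/q` then iterating the relation `(T y)^{qN} = y^{pN}` along the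
`T`-orbit of `y = δ u₀` through one full period gives `y^{q^n P} = y^{p^n P}`, hence `p = q`, hence `f` acts
trivially on `O^×(A)^pf`. Nothing here is specific to [IUTchIII] or abc.
-/

namespace Literature.AlgebraicGeometry.Frobenioids

open CategoryTheory

universe w v v' u u' um

namespace PreFrobenioidData

variable {C : Type u} [Category.{v} C] {D : Type u'} [Category.{v'} D] (S : PreFrobenioidData.{w} C D)

/-- **Divisor criterion for Frobenius-compactness** (Def. 1.2 (iv)): see the module docstring.
[cite: MochizukiFrdI2008, Def. 1.2 (iv) p.23] -/
theorem isFrobeniusCompact_of_divisorHom {A : C} {M : Type um} [CommGroup M]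
    (δ : S.unitsSubgroup A →* M) (hδ : Function.Injective δ)
    (T : Aut A →* MulAut M)
    (hact : ∀ (f : Aut A) (u : Aut A) (hu : u ∈ S.unitsSubgroup A),
      δ ⟨f * u * f⁻¹, S.conj_mem_unitsSubgroup f u hu⟩ = T f (δ ⟨u, hu⟩))
    (hfin : ∀ f : Aut A, ∃ n : ℕ, 0 < n ∧ T f ^ n = 1)
    (htf : ∀ (x : M) (n : ℕ), 0 < n → x ^ n = 1 → x = 1)
    (u₀ : Aut A) (hu₀ : u₀ ∈ S.unitsSubgroup A) (hy : δ ⟨u₀, hu₀⟩ ≠ 1) :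
    S.IsFrobeniusCompact A := by
  refine ⟨?_, ?_, ?_⟩
  · -- `O^×(A)` is commutative: `δ` is an injective homomorphism into a commutative group
    intro u hu u' hu'
    have h : δ (⟨u, hu⟩ * ⟨u', hu'⟩) = δ (⟨u', hu'⟩ * ⟨u, hu⟩) := by rw [map_mul, map_mul, mul_comm]
    exact congrArg Subtype.val (hδ h)
  · -- `u₀` is non-torsion
    refine ⟨u₀, hu₀, fun N hN hN1 => hy (htf _ N hN ?_)⟩
    rw [← map_pow]
    have : (⟨u₀, hu₀⟩ : S.unitsSubgroup A) ^ N = 1 := Subtype.ext hN1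
    rw [this, map_one]
  · -- the `λ`-clause
    intro f p q H u hu
    -- the `T_f`-orbit of `y := δ u₀`: `g k := f^k u₀ f^{-k}`, `y_k := δ (g k) = (T f)^k y`
    let g : ℕ → Aut A := fun k => f ^ k * u₀ * (f ^ k)⁻¹
    have hg : ∀ k, g k ∈ S.unitsSubgroup A := fun k => S.conj_mem_unitsSubgroup (f ^ k) u₀ hu₀
    have hg0 : g 0 = u₀ := by simp [g]
    have hgsucc : ∀ k, g (k + 1) = f * g k * f⁻¹ := by
      intro k; simp only [g, pow_succ', mul_inv_rev, mul_assoc]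
    have hy_succ : ∀ k, δ ⟨g (k + 1), hg (k + 1)⟩ = T f (δ ⟨g k, hg k⟩) := by
      intro k
      have := hact f (g k) (hg k)
      rw [← this]
      congr 1
      exact Subtype.ext (hgsucc k)
    have hy_k : ∀ k, δ ⟨g k, hg k⟩ = (T f ^ k) (δ ⟨u₀, hu₀⟩) := by
      intro k
      induction k with
      | zero =>
        rw [pow_zero, MulAut.one_apply]
        congr 1
        exact Subtype.ext hg0
      | succ k ih => rw [hy_succ, ih, pow_succ', MulAut.mul_apply]
    -- the exponents `N_k` given by the hypothesis along the orbit, and their product over one period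
    choose N hN using fun k => H (g k) (hg k)
    obtain ⟨n, hn, hTn⟩ := hfin f
    let P : ℕ := (Finset.range n).prod N
    have hP : 0 < P := Finset.prod_pos fun k _ => (hN k).1
    have hPdvd : ∀ k < n, N k ∣ P := fun k hk => Finset.dvd_prod_of_mem N (Finset.mem_range.mpr hk)
    -- `δ`-images of the relations: `y_{k+1}^{q N_k} = y_k^{p N_k}`
    have hrel : ∀ k, δ ⟨g (k + 1), hg (k + 1)⟩ ^ ((q : ℕ) * N k) = δ ⟨g k, hg k⟩ ^ ((p : ℕ) * N k) := by
      intro k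
      have h := (hN k).2
      have h' : (⟨f * g k * f⁻¹, S.conj_mem_unitsSubgroup f (g k) (hg k)⟩ : S.unitsSubgroup A) ^
          ((q : ℕ) * N k) = ⟨g k, hg k⟩ ^ ((p : ℕ) * N k) := Subtype.ext (by simpa [pow_mul] using h)
      have h'' := congrArg δ h'
      rw [map_pow, map_pow] at h''
      have hgk : (⟨f * g k * f⁻¹, S.conj_mem_unitsSubgroup f (g k) (hg k)⟩ : S.unitsSubgroup A) =
          ⟨g (k + 1), hg (k + 1)⟩ := Subtype.ext (hgsucc k).symm
      rw [hgk] at h''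
      exact h''
    -- induction through one period: `y_k^{q^k P} = y^{p^k P}` for `k ≤ n`
    set y := δ ⟨u₀, hu₀⟩ with hy_def
    have hind : ∀ k ≤ n, δ ⟨g k, hg k⟩ ^ ((q : ℕ) ^ k * P) = y ^ ((p : ℕ) ^ k * P) := by
      intro k hk
      induction k with
      | zero =>
        rw [show (⟨g 0, hg 0⟩ : S.unitsSubgroup A) = ⟨u₀, hu₀⟩ from Subtype.ext hg0]
        simp only [pow_zero, one_mul, hy_def]
      | succ k ih =>
        have hk' : k < n := Nat.lt_of_succ_le hk
        obtain ⟨m, hm⟩ := hPdvd k hk'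
        have e1 : (q : ℕ) ^ (k + 1) * P = ((q : ℕ) * N k) * ((q : ℕ) ^ k * m) := by
          rw [hm]; ring
        rw [e1, pow_mul, hrel k, ← pow_mul,
          show (p : ℕ) * N k * ((q : ℕ) ^ k * m) = (p : ℕ) * ((q : ℕ) ^ k * P) by rw [hm]; ring,
          mul_comm (p : ℕ) ((q : ℕ) ^ k * P), pow_mul, ih hk'.le, ← pow_mul]
        congr 1
        ring
    -- at `k = n` the orbit returns: `y_n = y`
    have hyn : δ ⟨g n, hg n⟩ = y := by rw [hy_k n, hTn, MulAut.one_apply]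
    have key : y ^ ((q : ℕ) ^ n * P) = y ^ ((p : ℕ) ^ n * P) := by rw [← hind n le_rfl, hyn]
    -- torsion-freeness: the two exponents agree
    have hexp : (q : ℕ) ^ n * P = (p : ℕ) ^ n * P := by
      by_contra hne
      rcases Nat.lt_or_gt_of_ne hne with hlt | hgt
      · have h1 : y ^ ((p : ℕ) ^ n * P - (q : ℕ) ^ n * P) = 1 := by
          rw [pow_sub y hlt.le, ← key, mul_inv_cancel]
        exact hy (htf y _ (Nat.sub_pos_of_lt hlt) h1)
      · have h1 : y ^ ((q : ℕ) ^ n * P - (p : ℕ) ^ n * P) = 1 := by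
          rw [pow_sub y hgt.le, key, mul_inv_cancel]
        exact hy (htf y _ (Nat.sub_pos_of_lt hgt) h1)
    have hpq : (p : ℕ) = q := by
      have h1 : (q : ℕ) ^ n = (p : ℕ) ^ n := Nat.eq_of_mul_eq_mul_right hP hexp
      exact (Nat.pow_left_injective hn.ne' h1).symm
    -- conclusion for the given unit `u`
    obtain ⟨N', hN', h⟩ := H u hu
    refine ⟨(q : ℕ) * N', Nat.mul_pos q.pos hN', ?_⟩
    rw [pow_mul, h, hpq, pow_mul]

end PreFrobenioidData

end Literature.AlgebraicGeometry.Frobenioids
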